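import Literature.Analysis.FluidPDE.TorusClassicalHnBalance
import Literature.Analysis.FluidPDE.EulerGalerkinLeibniz
import Literature.Analysis.FluidPDE.CompressibleEulerLinearizedDerivative
import Literature.Analysis.FunctionSpaces.TorusInverseLaplacianCalculus
import Literature.Analysis.FunctionSpaces.TorusClassicalNSUniqueness
import HarnessLib

/-!
# Stub `stub_pureBalance` of the line `SketchIdeator2` (card `separatrix-flux-pinning`)
# (crux `MarginalStabilityChain.ChainRealisation`, stmt-AnomalousDissipation-14249)

Sorry-free discharge of the registered stub `stub_pureBalance` (P1) of the lead's skeleton: the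
**pure-derivative energy balances** of classical Navier–Stokes solutions on `T³`.  For a
classical solution of `∂ₜu + (u·∇)u = νΔu − ∇p + f`, `div u = 0` on `[a, b] × T³` (`a < b`)
with smooth force slices, every coordinate `i`, every order `m` and every `t ∈ [a, b]`,

`d/dt ½∫‖∂ᵢᵐu‖² = −ν‖∇∂ᵢᵐu‖₂² − ∫⟪∂ᵢᵐ[(u·∇)u], ∂ᵢᵐu⟫ + ∫⟪∂ᵢᵐf, ∂ᵢᵐu⟫`

as a one-sided derivative within `[a, b]` — the identity behind every `Hᵐ` energy method
(Majda–Bertozzi 2002, Prop. 3.7; Foias–Manley–Rosa–Temam 2001, Ch. II App. A (A.55)).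

Paper proof (the tree's even-order balance
`IsClassicalNSSolutionOn.hasDerivWithinAt_half_integral_norm_sq_laplacian_iterate` with `Δⁿ`
replaced by `∂ᵢᵐ`).  (1) `s ↦ ∂ᵢᵐu(s)` is jointly smooth on `[a, b] × T³`
(`IsSmoothSpaceTimeOn.partialDeriv`, iterated), so `½∫‖∂ᵢᵐu‖²` may be differentiated under the
integral (`IsSmoothSpaceTimeOn.hasDerivWithinAt_integral`).  (2) `∂ₜ‖∂ᵢᵐu‖² = 2⟪∂ᵢᵐ∂ₜu, ∂ᵢᵐu⟫`,
since `∂ₜ∂ᵢᵐ = ∂ᵢᵐ∂ₜ` (`Torus.timeDerivWithin_partialDeriv_comm`, iterated).  (3) Insert the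
momentum equation `∂ₜu = νΔu − ∇p + f − (u·∇)u` and distribute `∂ᵢᵐ` over the sum (linearity
of `∂ᵢ` on smooth fields).  (4) The viscous term is `ν∫⟪∂ᵢᵐΔu, ∂ᵢᵐu⟫ = ν∫⟪Δ∂ᵢᵐu, ∂ᵢᵐu⟫ =
−ν‖∇∂ᵢᵐu‖₂²` (`Torus.partialDeriv_laplacian_comm`,
`Torus.integral_inner_laplacian_self_eq_neg_gradNormSq`), and the pressure term vanishes:
`∂ᵢᵐ∇p = ∇∂ᵢᵐp` (`CompressibleEuler.partialDeriv_gradient_eq`) is `L²`-orthogonal to the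
divergence-free field `∂ᵢᵐu` (`CompressibleEuler.partialDeriv_divergence_eq`,
`Torus.integral_inner_gradient_eq_zero_of_isDivFree`).
-/

set_option linter.dupNamespace false

noncomputable section

open MeasureTheory Set Filter Topology
open scoped InnerProductSpace
open Literature.Analysis.FunctionSpaces Literature.Analysis.FunctionSpaces.Torus
open Literature.Analysis.FluidPDE Literature.Analysis.FluidPDE.Torus

namespace Summit.AnomalousDissipation.AnomalousDissipation.Theorems.ChainRealisation.SeparatrixFluxPinning

/-- Local notation: the torus `T³`. -/
local notation "𝕋³" => UnitAddTorus (Fin 3)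
/-- Local notation: velocity values. -/
local notation "E³" => EuclideanSpace ℝ (Fin 3)

section IteratePartialDeriv

variable {d : Type*} [Fintype d] [DecidableEq d]
variable {F : Type*} [NormedAddCommGroup F] [NormedSpace ℝ F]

/-- `∂ᵢᵐ(g + h) = ∂ᵢᵐg + ∂ᵢᵐh` for smooth `g, h` on the torus. -/
theorem pureBalance_iterate_partialDeriv_add {g h : UnitAddTorus d → F} (hg : IsSmooth g)
    (hh : IsSmooth h) (i : d) : ∀ m : ℕ,
      (partialDeriv i)^[m] (g + h) = (partialDeriv i)^[m] g + (partialDeriv i)^[m] h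
  | 0 => rfl
  | m + 1 => by
    rw [Function.iterate_succ_apply', Function.iterate_succ_apply', Function.iterate_succ_apply',
      pureBalance_iterate_partialDeriv_add hg hh i m]
    exact partialDeriv_add ((isSmooth_iterate_partialDeriv hg i m).isContDiff (by simp))
      ((isSmooth_iterate_partialDeriv hh i m).isContDiff (by simp)) i

/-- `∂ᵢᵐ(g - h) = ∂ᵢᵐg - ∂ᵢᵐh` for smooth `g, h` on the torus. -/
theorem pureBalance_iterate_partialDeriv_sub {g h : UnitAddTorus d → F} (hg : IsSmooth g)
    (hh : IsSmooth h) (i : d) : ∀ m : ℕ,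
      (partialDeriv i)^[m] (g - h) = (partialDeriv i)^[m] g - (partialDeriv i)^[m] h
  | 0 => rfl
  | m + 1 => by
    rw [Function.iterate_succ_apply', Function.iterate_succ_apply', Function.iterate_succ_apply',
      pureBalance_iterate_partialDeriv_sub hg hh i m]
    exact partialDeriv_sub ((isSmooth_iterate_partialDeriv hg i m).isContDiff (by simp))
      ((isSmooth_iterate_partialDeriv hh i m).isContDiff (by simp)) i

/-- `∂ᵢᵐ(c • g) = c • ∂ᵢᵐg` for smooth `g` on the torus. -/
theorem pureBalance_iterate_partialDeriv_const_smul {g : UnitAddTorus d → F} (hg : IsSmooth g)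
    (c : ℝ) (i : d) : ∀ m : ℕ, (partialDeriv i)^[m] (c • g) = c • (partialDeriv i)^[m] g
  | 0 => rfl
  | m + 1 => by
    rw [Function.iterate_succ_apply', Function.iterate_succ_apply',
      pureBalance_iterate_partialDeriv_const_smul hg c i m]
    exact partialDeriv_const_smul ((isSmooth_iterate_partialDeriv hg i m).isContDiff (by simp)) c i

/-- `∂ᵢᵐ(Δg) = Δ(∂ᵢᵐg)` for smooth `g` on the torus (Schwarz, `Torus.partialDeriv_laplacian_comm`,
iterated). -/
theorem pureBalance_iterate_partialDeriv_laplacian {g : UnitAddTorus d → F} (hg : IsSmooth g)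
    (i : d) : ∀ m : ℕ, (partialDeriv i)^[m] (laplacian g) = laplacian ((partialDeriv i)^[m] g)
  | 0 => rfl
  | m + 1 => by
    rw [Function.iterate_succ_apply', Function.iterate_succ_apply',
      pureBalance_iterate_partialDeriv_laplacian hg i m]
    funext x
    exact partialDeriv_laplacian_comm (isSmooth_iterate_partialDeriv hg i m) i x

/-- `∂ᵢᵐ(∇q) = ∇(∂ᵢᵐq)` for a smooth scalar `q` on the torus
(`CompressibleEuler.partialDeriv_gradient_eq`, iterated). -/
theorem pureBalance_iterate_partialDeriv_gradient {q : UnitAddTorus d → ℝ} (hq : IsSmooth q)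
    (i : d) : ∀ m : ℕ,
      (partialDeriv i)^[m] (Torus.gradient q) = Torus.gradient ((partialDeriv i)^[m] q)
  | 0 => rfl
  | m + 1 => by
    rw [Function.iterate_succ_apply', Function.iterate_succ_apply',
      pureBalance_iterate_partialDeriv_gradient hq i m]
    funext x
    exact CompressibleEuler.partialDeriv_gradient_eq (isSmooth_iterate_partialDeriv hq i m) i x

/-- Pure iterated partial derivatives of a smooth divergence-free field are divergence free
(`div ∂ᵢw = ∂ᵢ div w`, `CompressibleEuler.partialDeriv_divergence_eq`). -/
theorem pureBalance_isDivFree_iterate_partialDeriv {w : UnitAddTorus d → EuclideanSpace ℝ d}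
    (hw : IsSmooth w) (hdiv : IsDivFree w) (i : d) :
    ∀ m : ℕ, IsDivFree ((partialDeriv i)^[m] w)
  | 0 => hdiv
  | m + 1 => by
    intro x
    rw [Function.iterate_succ_apply',
      ← CompressibleEuler.partialDeriv_divergence_eq (isSmooth_iterate_partialDeriv hw i m) i x]
    have h0 : divergence ((partialDeriv i)^[m] w) = fun _ => (0 : ℝ) :=
      funext (pureBalance_isDivFree_iterate_partialDeriv hw hdiv i m)
    rw [h0]
    simp [partialDeriv, Torus.lineDeriv]

/-- `s ↦ ∂ᵢᵐu(s)` is jointly smooth on `S × T^d` when `u` is (on time sets of unique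
differentiability; `IsSmoothSpaceTimeOn.partialDeriv`, iterated). -/
theorem pureBalance_isSmoothSpaceTimeOn_iterate_partialDeriv {S : Set ℝ}
    {u : ℝ → UnitAddTorus d → F} (hu : IsSmoothSpaceTimeOn S u) (hS : UniqueDiffOn ℝ S) (i : d) :
    ∀ m : ℕ, IsSmoothSpaceTimeOn S (fun s => (partialDeriv i)^[m] (u s))
  | 0 => hu
  | m + 1 => by
    have e : (fun s => (partialDeriv i)^[m + 1] (u s)) =
        fun s => partialDeriv i ((partialDeriv i)^[m] (u s)) :=
      funext fun s => Function.iterate_succ_apply' (partialDeriv i) m (u s)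
    rw [e]
    exact (pureBalance_isSmoothSpaceTimeOn_iterate_partialDeriv hu hS i m).partialDeriv hS i

/-- `∂ₜ∂ᵢᵐ = ∂ᵢᵐ∂ₜ` for jointly smooth fields on `[a, b] × T^d` (one-sided in time at the
endpoints; `Torus.timeDerivWithin_partialDeriv_comm`, iterated). -/
theorem pureBalance_timeDerivWithin_iterate_partialDeriv_comm {a b : ℝ} {u : ℝ → UnitAddTorus d → F}
    (hab : a < b) (hu : IsSmoothSpaceTimeOn (Icc a b) u) (i : d) :
    ∀ m : ℕ, ∀ {t : ℝ}, t ∈ Icc a b → ∀ x : UnitAddTorus d,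
      timeDerivWithin (Icc a b) (fun s => (partialDeriv i)^[m] (u s)) t x =
        ((partialDeriv i)^[m] (timeDerivWithin (Icc a b) u t)) x
  | 0, _, _, _ => rfl
  | m + 1, t, ht, x => by
    have hS : UniqueDiffOn ℝ (Icc a b) := uniqueDiffOn_Icc hab
    have e : (fun s => (partialDeriv i)^[m + 1] (u s)) =
        fun s => partialDeriv i ((partialDeriv i)^[m] (u s)) :=
      funext fun s => Function.iterate_succ_apply' (partialDeriv i) m (u s)
    rw [e, timeDerivWithin_partialDeriv_comm hab
      (pureBalance_isSmoothSpaceTimeOn_iterate_partialDeriv hu hS i m) ht i x,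
      Function.iterate_succ_apply']
    have e2 : timeDerivWithin (Icc a b) (fun s => (partialDeriv i)^[m] (u s)) t =
        (partialDeriv i)^[m] (timeDerivWithin (Icc a b) u t) :=
      funext fun z => pureBalance_timeDerivWithin_iterate_partialDeriv_comm hab hu i m ht z
    rw [e2]

end IteratePartialDeriv

/-- **Stub `stub_pureBalance` (P1 of the line `SketchIdeator2`): the pure-derivative balances of
classical Navier–Stokes solutions on `T³`.**  For a classical solution of
`∂ₜu + (u·∇)u = νΔu − ∇p + f`, `div u = 0` on `[a, b] × T³` (`a < b`) with smooth force slices,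
every coordinate `i`, every order `m` and every `t ∈ [a, b]`:
`d/dt ½∫‖∂ᵢᵐu‖² = −ν‖∇∂ᵢᵐu‖₂² − ∫⟪∂ᵢᵐ[(u·∇)u], ∂ᵢᵐu⟫ + ∫⟪∂ᵢᵐf, ∂ᵢᵐu⟫` within `[a, b]`
(Majda–Bertozzi 2002, Prop. 3.7; Foias–Manley–Rosa–Temam 2001, Ch. II App. A (A.55)).
Differentiate under `∫`, commute `∂ₜ` with `∂ᵢᵐ`, insert the momentum equation, split `∂ᵢᵐ` over
the sum; the viscous term is `−ν gradNormSq (∂ᵢᵐu)` by Green's first identity and the pressure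
term vanishes because `∂ᵢᵐu` is divergence free. -/
theorem stub_pureBalance :
    ∀ (a b ν : ℝ) (f u : ℝ → 𝕋³ → E³) (p : ℝ → 𝕋³ → ℝ),
      IsClassicalNSSolutionOn (Icc a b) ν f u p → a < b → (∀ t ∈ Icc a b, IsSmooth (f t)) →
      ∀ (i : Fin 3) (m : ℕ) (t : ℝ), t ∈ Icc a b →
      HasDerivWithinAt (fun s => 2⁻¹ * ∫ x, ‖((partialDeriv i)^[m] (u s)) x‖ ^ 2)
        (-ν * gradNormSq ((partialDeriv i)^[m] (u t)) -
            (∫ x, ⟪((partialDeriv i)^[m] (convect (u t) (u t))) x, ((partialDeriv i)^[m] (u t)) x⟫_ℝ) +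
          ∫ x, ⟪((partialDeriv i)^[m] (f t)) x, ((partialDeriv i)^[m] (u t)) x⟫_ℝ)
        (Icc a b) t := by
  intro a b ν f u p h hab hf i m t ht
  set S : Set ℝ := Icc a b with hSdef
  have hSc : Convex ℝ S := convex_Icc a b
  have hU : UniqueDiffOn ℝ S := uniqueDiffOn_Icc hab
  have hu : IsSmoothSpaceTimeOn S u := h.smooth_velocity
  have hut : IsSmooth (u t) := hu.isSmooth_slice ht
  have hpt : IsSmooth (p t) := h.smooth_pressure.isSmooth_slice ht
  have hft : IsSmooth (f t) := hf t ht
  have hA : IsSmooth (timeDerivWithin S u t) := hu.isSmooth_timeDerivWithin hU ht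
  have hΔ : IsSmooth (laplacian (u t)) := hut.laplacian
  have hC : IsSmooth (convect (u t) (u t)) := hut.convect hut
  have hWst : IsSmoothSpaceTimeOn S (fun s => (partialDeriv i)^[m] (u s)) :=
    pureBalance_isSmoothSpaceTimeOn_iterate_partialDeriv hu hU i m
  -- notation: `W = ∂ᵢᵐu(t)`, `D g = ∂ᵢᵐ g`
  have hD : ∀ {g : 𝕋³ → E³}, IsSmooth g → IsSmooth ((partialDeriv i)^[m] g) := fun hg =>
    isSmooth_iterate_partialDeriv hg i m
  have hW : IsSmooth ((partialDeriv i)^[m] (u t)) := hD hut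
  -- Step 1: differentiate `½ ∫ ‖∂ᵢᵐu‖²` under the integral sign.
  have hφ : IsSmoothSpaceTimeOn S (fun s x => ‖((partialDeriv i)^[m] (u s)) x‖ ^ 2) :=
    hWst.norm_sq ℝ
  have hE : HasDerivWithinAt (fun s => 2⁻¹ * ∫ x, ‖((partialDeriv i)^[m] (u s)) x‖ ^ 2)
      (2⁻¹ * ∫ x, timeDerivWithin S
        (fun s x => ‖((partialDeriv i)^[m] (u s)) x‖ ^ 2) t x) S t :=
    (hφ.hasDerivWithinAt_integral hSc ht).const_mul 2⁻¹
  -- Step 2: `∂ₜ ‖∂ᵢᵐu‖² = 2 ⟪∂ᵢᵐ∂ₜu, ∂ᵢᵐu⟫`.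
  have htd : ∀ x, timeDerivWithin S (fun s x => ‖((partialDeriv i)^[m] (u s)) x‖ ^ 2) t x =
      2 * ⟪((partialDeriv i)^[m] (timeDerivWithin S u t)) x, ((partialDeriv i)^[m] (u t)) x⟫_ℝ := by
    intro x
    have h1 := ((hWst.hasDerivWithinAt_slice ht x).norm_sq).derivWithin (hU t ht)
    rw [timeDerivWithin, h1,
      ← pureBalance_timeDerivWithin_iterate_partialDeriv_comm hab hu i m ht x, real_inner_comm]
  have hE' : 2⁻¹ * ∫ x, timeDerivWithin S
        (fun s x => ‖((partialDeriv i)^[m] (u s)) x‖ ^ 2) t x =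
      ∫ x, ⟪((partialDeriv i)^[m] (timeDerivWithin S u t)) x,
        ((partialDeriv i)^[m] (u t)) x⟫_ℝ := by
    simp_rw [htd, integral_const_mul]
    ring
  rw [hE'] at hE
  convert hE using 1
  -- Step 3: insert the momentum equation and distribute `∂ᵢᵐ`.
  have hA_eq : timeDerivWithin S u t =
      ν • laplacian (u t) - Torus.gradient (p t) + f t - convect (u t) (u t) := by
    funext x
    rw [Pi.sub_apply, Pi.add_apply, Pi.sub_apply, Pi.smul_apply, ← h.momentum t ht x]
    abel
  have hDA : (partialDeriv i)^[m] (timeDerivWithin S u t) =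
      ν • laplacian ((partialDeriv i)^[m] (u t)) -
        Torus.gradient ((partialDeriv i)^[m] (p t)) +
        (partialDeriv i)^[m] (f t) - (partialDeriv i)^[m] (convect (u t) (u t)) := by
    rw [hA_eq, pureBalance_iterate_partialDeriv_sub (((hΔ.smul ν).sub hpt.gradient).add hft) hC i m,
      pureBalance_iterate_partialDeriv_add ((hΔ.smul ν).sub hpt.gradient) hft i m,
      pureBalance_iterate_partialDeriv_sub (hΔ.smul ν) hpt.gradient i m,
      pureBalance_iterate_partialDeriv_const_smul hΔ ν i m,
      pureBalance_iterate_partialDeriv_laplacian hut i m,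
      pureBalance_iterate_partialDeriv_gradient hpt i m]
  -- Step 4: split the integral; viscous and pressure terms.
  have hq : IsSmooth ((partialDeriv i)^[m] (p t)) := isSmooth_iterate_partialDeriv hpt i m
  have iL : Integrable (fun x => ⟪(ν • laplacian ((partialDeriv i)^[m] (u t))) x,
      ((partialDeriv i)^[m] (u t)) x⟫_ℝ) volume :=
    ((hW.laplacian.smul ν).inner hW).integrable
  have iG : Integrable (fun x => ⟪Torus.gradient ((partialDeriv i)^[m] (p t)) x,
      ((partialDeriv i)^[m] (u t)) x⟫_ℝ) volume :=
    (hq.gradient.inner hW).integrable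
  have iF : Integrable (fun x => ⟪((partialDeriv i)^[m] (f t)) x,
      ((partialDeriv i)^[m] (u t)) x⟫_ℝ) volume :=
    ((hD hft).inner hW).integrable
  have iC : Integrable (fun x => ⟪((partialDeriv i)^[m] (convect (u t) (u t))) x,
      ((partialDeriv i)^[m] (u t)) x⟫_ℝ) volume :=
    ((hD hC).inner hW).integrable
  have hsplit : ∫ x, ⟪((partialDeriv i)^[m] (timeDerivWithin S u t)) x,
        ((partialDeriv i)^[m] (u t)) x⟫_ℝ =
      (∫ x, ⟪(ν • laplacian ((partialDeriv i)^[m] (u t))) x, ((partialDeriv i)^[m] (u t)) x⟫_ℝ) -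
        (∫ x, ⟪Torus.gradient ((partialDeriv i)^[m] (p t)) x, ((partialDeriv i)^[m] (u t)) x⟫_ℝ) +
        (∫ x, ⟪((partialDeriv i)^[m] (f t)) x, ((partialDeriv i)^[m] (u t)) x⟫_ℝ) -
        ∫ x, ⟪((partialDeriv i)^[m] (convect (u t) (u t))) x,
          ((partialDeriv i)^[m] (u t)) x⟫_ℝ := by
    simp_rw [hDA, Pi.sub_apply, Pi.add_apply, Pi.sub_apply, inner_sub_left, inner_add_left,
      inner_sub_left]
    rw [integral_sub ?_ iC, integral_add ?_ iF, integral_sub iL iG]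
    · exact iL.sub iG
    · exact (iL.sub iG).add iF
  have hvisc : ∫ x, ⟪(ν • laplacian ((partialDeriv i)^[m] (u t))) x,
        ((partialDeriv i)^[m] (u t)) x⟫_ℝ = -ν * gradNormSq ((partialDeriv i)^[m] (u t)) := by
    simp_rw [Pi.smul_apply, real_inner_smul_left, integral_const_mul]
    rw [integral_inner_laplacian_self_eq_neg_gradNormSq hW]
    ring
  have hpres : ∫ x, ⟪Torus.gradient ((partialDeriv i)^[m] (p t)) x,
      ((partialDeriv i)^[m] (u t)) x⟫_ℝ = 0 :=
    integral_inner_gradient_eq_zero_of_isDivFree hW hq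
      (pureBalance_isDivFree_iterate_partialDeriv hut (h.divFree t ht) i m)
  rw [hsplit, hvisc, hpres]
  ring

end Summit.AnomalousDissipation.AnomalousDissipation.Theorems.ChainRealisation.SeparatrixFluxPinning

end
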